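import Summits.BirchSwinnertonDyer.Rank1Residual.X11a.ChainAnyLevel
import Summits.BirchSwinnertonDyer.Rank1Residual.X9.HessePartnerTransport
import Summits.BirchSwinnertonDyer.BirchSwinnertonDyer.Theses.PrintX11a
import Literature.NumberTheory.EllipticCurves.EmertonPollackWestonMuAnTransferToMultiplicative
import HarnessLib

/-!
# Crux 19064 `X11aLowerHalf` on the surjective sub-leaf — road p2 (μ-TRANSPORT from a good-ordinary
# `p`-congruent partner): `BSD(E,p)` and the lower half at an X11a pair from a LEVEL-LOWERED partner
# carrying ONE unit coefficient (cell `bsd-print-x11a`, seat p2, `--supports` item 19064)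

HONEST FRAMING. Theorems only; no definition; ONE new cite-only named fact is consumed as a binder
(Emerton–Pollack–Weston 2006 Thm. 1, `∗ = an`, read from a GOOD ORDINARY member to a MULTIPLICATIVE
member of the Hida family `H(E[p])`: `Literature.NumberTheory.EllipticCurves.
thm1_muAn_transfer_goodOrdinary_to_multiplicative`, file `EmertonPollackWestonMuAnTransferToMultiplicative`,
statement-only, D-0014, typed by this seat, p541295). Nothing is booked; the crux `X11aLowerHalf`
(item stmt-BirchSwinnertonDyer-19064, shared by routes ErratumRoadFive and PrintX11a) stays OPEN;
class-wide the displayed input is Greenberg's `μ`-conjecture for irreducible `E[p]` (LADDER barrier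
B3), exactly as for the chain of record. beyond-print theorem: NO.

THE ROAD. p2's strategy sentence («manufacture the auxiliary prime by level-RAISING, transport along
the congruence») has no target at `p ≥ 5`: Skinner's (ram) is an invariant of `E[p]`
(`RamCongruence.ram_iff_of_torsionIso`, p533324). What survives of «transport along the congruence»
is the ANALYTIC `μ`-invariant — a `ρ̄`-invariant by Emerton–Pollack–Weston 2006 Thm. 1 — fed to the
chain of record of class X11a (`X11a.forall_bsdp_of_namedFacts_ofLevel_heightFree`, 12 named
published facts: on X11a ∩ {`p ≥ 5`, `ρ̄_{E,p}` onto}, `MuAnZeroAt W p ⟹ BSD(E,p)`):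
* `muAnZeroAt_of_goodOrdinaryPartner` — `E = W` multiplicative at `p ≥ 5`, `E[p]` irreducible; `A`
  globally minimal, GOOD ORDINARY at `p`, a `Γ_ℚ`-equivariant `A[p] ≃ E[p]` (so `E[p]` is finite at
  `p`: the partner is LEVEL-LOWERED at `p`, `p ∣ ord_p Δ_min(E)`), `μ^an(A,p) = 0` in the
  Greenberg–Vatsal shape ⟹ `X11a.MuAnZeroAt W p`, by the new fact ALONE;
* `muAnZeroAt_of_unitCoeffPartner`, `muAnZeroAt_of_unitLValuePartner` — the two cheapest SOURCES of
  the partner's certificate: a unit coefficient of `L_p(f, α_A)` for every newform `f` of `A` (modular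
  symbols on the SMALL conductor `N_A ∣ N_E/p`), or — no engine at all — `A` non-anomalous with
  `L(A,1)/Ω_A` a `p`-adic unit (lane X9's `X9.unitCoeff_zero_of_lvalue`, period unit `h5`);
* `bsdp_of_goodOrdinaryPartner_of_surj`, `missingLowerBoundAt_of_goodOrdinaryPartner_of_surj` —
  `BSD(E,p)` and the LOWER HALF `Typed.MissingLowerBoundAt W p` at every X11a pair with `p ≥ 5`, `ρ̄`
  onto and such a partner (12 chain facts + the new fact; per-pair data displayed);
* `x11aLowerHalf_onSurjFive_of_forall_exists_goodOrdinaryPartner` and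
  `x11aLowerHalf_of_forall_exists_goodOrdinaryPartner_of_three_of_nonSurj` — the surjective `p ≥ 5`
  sub-leaf, and crux `Theses.PrintX11a.X11aLowerHalf` BY NAME, from ONE displayed class-wide
  hypothesis «every surjective X11a pair with `p ≥ 5` has a good-ordinary `p`-congruent partner with
  `μ^an = 0`» (+ the `p = 3` and non-surjective sub-leaf statements). NOT a published fact, NOT
  claimed: it FAILS at every très ramifié pair (`p ∤ ord_p Δ_min(E)` ⟹ no partner is good at `p`;
  e.g. the engine-less leaf pairs `285660k1 @5`, `244068m1 @11`, `429975cr1 @13`, `206856cb1 @17`,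
  kit j280133), where the pair's own certificate is needed; on the peu ramifié surjective sub-leaf it
  is a per-pair ∃-statement (Rubin–Silverberg: `X_E(5) ≅ ℙ¹` makes `5`-congruent partners abundant).

VERSUS ROUTE (3d) (`X11a.bsdp_of_trivialPartner`: `Sel_{p^∞}(A) = 0`, `p ∤ ∏ c_ℓ(A)`, unit
`L`-value, non-anomalous; BCS 2025 Thm. 1.1.2 (a) + EPW Cor. 5.1.4): no Selmer / Tamagawa certificate
of the partner, partners of ANY rank (one unit coefficient), at the price of `ρ̄_{E,p}` onto and the
chain's Hida-member facts; `μ^an` of `E` is read on a member of conductor `N_A ∣ N/p`.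

References: [EmertonPollackWeston2006] Thm. 1, Ex. 5.3.1; [GreenbergVatsal2000] §3 Prop. (3.1),
Rem. (3.4); [Skinner2016PacificMC] §3.3; [MazurTateTeitelbaum1986Invent] §I.14; [GreenbergLNM1716]
Conj. 1.11; cell files HOME/PLAN.md §2 (p2), p533324, p534721 (p2 g0), p535822 (p1).
-/

set_option linter.dupNamespace false -- the directory name repeats the summit name (sibling precedent)

set_option autoImplicit false

noncomputable section

open scoped Classical MatrixGroups ModularForm

open CongruenceSubgroup WeierstrassCurve Field
open Literature.NumberTheory.EllipticCurves Literature.NumberTheory.EllipticCurves.ModularForms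
  Literature.NumberTheory.EllipticCurves.Rank1Residual
  Literature.NumberTheory.EllipticCurves.Rank1Residual.Typed
  Literature.NumberTheory.EllipticCurves.Wuthrich2014
  Literature.NumberTheory.EllipticCurves.SteinWuthrich2013
  Literature.NumberTheory.EllipticCurves.GreenbergVatsal2000
  Literature.NumberTheory.EllipticCurves.EmertonPollackWeston2006
  Summit.BirchSwinnertonDyer.Rank1Residual
  Summit.BirchSwinnertonDyer.Rank1Residual.RankZeroHeightFree

namespace Summit.BirchSwinnertonDyer.BirchSwinnertonDyer.Theorems.MuTransport

/-! ### §1 The partner's certificate moves to the multiplicative curve -/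

section Transport

variable (W A : WeierstrassCurve ℚ) [W.IsElliptic] [W.IsGloballyMinimal] [A.IsElliptic]
  [A.IsGloballyMinimal] (p : ℕ) [Fact p.Prime]

/-- **`μ^an(E,p) = 0` at a multiplicative prime from a good-ordinary `p`-congruent partner with
`μ^an = 0`.** `E = W` globally minimal, multiplicative at `p ≥ 5`, `E[p]` irreducible; `A` globally
minimal, good ordinary at `p`, with a `Γ_ℚ`-equivariant additive isomorphism `A[p] ≃ E[p]` (`hiso`) and
the Greenberg–Vatsal-shaped certificate `hμA` (for the newform `f₁` of `A` at level `N_A` and every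
`ϖ₁` with `ϖ₁·Ω_A = Ω⁺_{f₁}`, a unit coefficient of `ϖ₁·L_p(f₁, α_A)`). Then `X11a.MuAnZeroAt W p`.
ONE input: EPW 2006 Thm. 1 `∗ = an` good ordinary → multiplicative (`hT1`, cite-only); irreducibility
of `A[p]` is that of `E[p]` transported along `hiso`. [cite: EmertonPollackWeston2006, Thm. 1 (arXiv:math/0404484 p. 2) and Ex. 5.3.1] -/
theorem muAnZeroAt_of_goodOrdinaryPartner (hT1 : thm1_muAn_transfer_goodOrdinary_to_multiplicative)
    (hp : 5 ≤ p) (hmult : W.HasMultiplicativeReductionAtPrime p)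
    (hirr : W.HasIrreducibleModPGaloisRep p)
    (hgoodA : A.HasGoodReductionAtPrime p) (hordA : ¬ (p : ℤ) ∣ A.frobeniusTrace p)
    (hiso : ∃ e : geomTorsion A (p : ℤ) ≃+ geomTorsion W (p : ℤ),
      ∀ (σ : Field.absoluteGaloisGroup ℚ) (P : geomTorsion A (p : ℤ)), e (σ • P) = σ • e P)
    (hμA : ∀ [NeZero (A.conductorNorm ℤ)] (f₁ : CuspForm (Gamma0 (A.conductorNorm ℤ)) 2),
        IsNewformOf A f₁ → ∀ (ϖ₁ : ℚ), (ϖ₁ : ℝ) * A.realPeriodRat = plusPeriod f₁ →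
      ∃ n : ℕ, ‖PowerSeries.coeff n
        (PowerSeries.C (ϖ₁ : ℚ_[p]) * padicLFunction f₁ (unitRoot A p : ℚ_[p]))‖ = 1) :
    X11a.MuAnZeroAt W p := by
  obtain ⟨e, he⟩ := hiso
  intro N _ f hf ϖ hϖ
  exact hT1 A W p hp hgoodA hordA hmult ⟨e, he⟩ (hasIrreducibleModPGaloisRep_of_torsionIso_symm e he
    hirr) (fun f₁ hf₁ ϖ₁ hϖ₁ => hμA f₁ hf₁ ϖ₁ hϖ₁) f hf ϖ hϖ

/-- **Source 1 of the partner's certificate: a unit coefficient of `L_p(f, α_A)` for every newform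
`f` of `A`** (the shape a modular-symbol engine delivers on the partner's conductor; `ϖ`-free). The
period ratio `ϖ₁` is a `p`-adic unit by Greenberg–Vatsal Rem. 3.4 (`h5`, cite-only), so the
Greenberg–Vatsal-shaped certificate follows and `muAnZeroAt_of_goodOrdinaryPartner` applies.
[cite: EmertonPollackWeston2006, Thm. 1 (arXiv:math/0404484 p. 2)] [cite: GreenbergVatsal2000, §3 Remark (3.4)] -/
theorem muAnZeroAt_of_unitCoeffPartner (hT1 : thm1_muAn_transfer_goodOrdinary_to_multiplicative)
    (h5 : realPeriodRat_eq_unit_mul_plusPeriod)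
    (hp : 5 ≤ p) (hmult : W.HasMultiplicativeReductionAtPrime p)
    (hirr : W.HasIrreducibleModPGaloisRep p)
    (hgoodA : A.HasGoodReductionAtPrime p) (hordA : ¬ (p : ℤ) ∣ A.frobeniusTrace p)
    (hiso : ∃ e : geomTorsion A (p : ℤ) ≃+ geomTorsion W (p : ℤ),
      ∀ (σ : Field.absoluteGaloisGroup ℚ) (P : geomTorsion A (p : ℤ)), e (σ • P) = σ • e P)
    (hcertA : ∀ {N : ℕ} [NeZero N] (f : CuspForm (Gamma0 N) 2), IsNewformOf A f →
      ∃ n : ℕ, ‖PowerSeries.coeff n (padicLFunction f (unitRoot A p : ℚ_[p]))‖ = 1) :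
    X11a.MuAnZeroAt W p := by
  have hirrA : A.HasIrreducibleModPGaloisRep p := by
    obtain ⟨e, he⟩ := hiso
    exact hasIrreducibleModPGaloisRep_of_torsionIso_symm e he hirr
  -- the Greenberg–Vatsal-shaped certificate of `A`: the period ratio `ϖ₁` is a `p`-adic unit
  have hμA : ∀ [NeZero (A.conductorNorm ℤ)] (f₁ : CuspForm (Gamma0 (A.conductorNorm ℤ)) 2),
      IsNewformOf A f₁ → ∀ (ϖ₁ : ℚ), (ϖ₁ : ℝ) * A.realPeriodRat = plusPeriod f₁ →
      ∃ n : ℕ, ‖PowerSeries.coeff n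
        (PowerSeries.C (ϖ₁ : ℚ_[p]) * padicLFunction f₁ (unitRoot A p : ℚ_[p]))‖ = 1 := by
    intro _ f₁ hf₁ ϖ₁ hϖ₁
    have hϖ₁norm : ‖(ϖ₁ : ℚ_[p])‖ = 1 :=
      norm_periodRatio_eq_one h5 A p hp hgoodA hirrA f₁ hf₁ ϖ₁ hϖ₁
    obtain ⟨n, hn⟩ := hcertA f₁ hf₁
    exact ⟨n, by rw [PowerSeries.coeff_C_mul, norm_mul, hϖ₁norm, one_mul, hn]⟩
  intro N _ f hf ϖ hϖ
  exact muAnZeroAt_of_goodOrdinaryPartner W A p hT1 hp hmult hirr hgoodA hordA hiso hμA f hf ϖ hϖ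

/-- **Source 2 of the partner's certificate: a unit `L`-VALUE, no engine at all.** If the partner `A`
(good ordinary at `p ≥ 5`, `A[p] ≃ E[p]`) is NON-ANOMALOUS (`p ∤ #Ã(𝔽_p)`) and `L(A,1)/Ω_A = q`
with `q ≠ 0`, `ord_p q = 0`, then the CONSTANT coefficient of `ϖ·L_p(f_A, α_A)` is a unit (lane X9's
`X9.unitCoeff_zero_of_lvalue`: Mazur–Tate–Teitelbaum interpolation `L_p(0) = (1 − α⁻¹)²·L(A,1)/Ω⁺_f`
+ the period unit `h5`), hence `X11a.MuAnZeroAt W p`. In rank `0` the hypothesis reads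
`p ∤ #Ш(A)_an·∏ c_ℓ(A)` (torsion is prime to `p` for irreducible `A[p]`).
[cite: MazurTateTeitelbaum1986Invent, §I.14 (14.3)] [cite: GreenbergVatsal2000, §3 Remark (3.4)]
[cite: EmertonPollackWeston2006, Thm. 1 (arXiv:math/0404484 p. 2)] -/
theorem muAnZeroAt_of_unitLValuePartner (hT1 : thm1_muAn_transfer_goodOrdinary_to_multiplicative)
    (h5 : realPeriodRat_eq_unit_mul_plusPeriod)
    (hp : 5 ≤ p) (hmult : W.HasMultiplicativeReductionAtPrime p)
    (hirr : W.HasIrreducibleModPGaloisRep p)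
    (hgoodA : A.HasGoodReductionAtPrime p) (hordA : ¬ (p : ℤ) ∣ A.frobeniusTrace p)
    (hiso : ∃ e : geomTorsion A (p : ℤ) ≃+ geomTorsion W (p : ℤ),
      ∀ (σ : Field.absoluteGaloisGroup ℚ) (P : geomTorsion A (p : ℤ)), e (σ • P) = σ • e P)
    (hna : ¬ p ∣ A.reductionPointCount p)
    {q : ℚ} (hq0 : q ≠ 0) (hL : A.entireLFunction 1 / (A.realPeriodRat : ℂ) = (q : ℂ))
    (hq : padicValRat p q = 0) :
    X11a.MuAnZeroAt W p := by
  have hirrA : A.HasIrreducibleModPGaloisRep p := by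
    obtain ⟨e, he⟩ := hiso
    exact hasIrreducibleModPGaloisRep_of_torsionIso_symm e he hirr
  intro N _ f hf ϖ hϖ
  exact muAnZeroAt_of_goodOrdinaryPartner W A p hT1 hp hmult hirr hgoodA hordA hiso
    (X9.unitCoeff_zero_of_lvalue h5 A p hp hgoodA hordA hirrA hna hq0 hL hq) f hf ϖ hϖ

end Transport

/-! ### §2 `BSD(E,p)` and the lower half at a surjective X11a pair with a partner -/

section Pair

variable (W A : WeierstrassCurve ℚ) [W.IsElliptic] [W.IsGloballyMinimal] [A.IsElliptic]
  [A.IsGloballyMinimal] (p : ℕ) [Fact p.Prime]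

/-- **`BSD(E,p)` at an X11a pair with `p ≥ 5`, `ρ̄_{E,p}` onto, from a good-ordinary `p`-congruent
partner with `μ^an = 0`**: the 12 NAMED PUBLISHED FACTS of the chain of record
`X11a.forall_bsdp_of_namedFacts_ofLevel_heightFree` + the new cite-only EPW Thm. 1 (an) (`hT1`);
per-pair data: the class, `5 ≤ p`, `Surj W p`, the partner (`hgoodA`, `hordA`, `hiso`, `hμA`).
[cite: EmertonPollackWeston2006, Thm. 1, Thm. 3.1.1, Thm. 5.1.3] [cite: Wan2015, Thm. 4]
[cite: SteinWuthrich2013, Thm. 6.1 (p. 20)] [cite: Wuthrich2014, Thm. 3 and Cor. 19] -/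
theorem bsdp_of_goodOrdinaryPartner_of_surj (hNf : exists_isNewformOf)
    (h311 : thm311_cotorsion_weightK_member_ofLevel) (hT1a : thm1_muAlg_of_weightK_member_ofLevel)
    (hT2 : Wan2015.thm4_rational_weightK_member_of_bdd_ofLevel)
    (hT1b : thm513_transfer_from_weightK_member_of_bdd_ofLevel)
    (h61 : DeligneSerre1974.thm61_exists_adicGaloisRep) (h326 : Hida2000_thm326_ordinary)
    (hKato : kato_charIdeal_dvd_multiplicative_of_surjective)
    (hJs : thm61_splitMultiplicative) (hJn : thm61_nonsplitMultiplicative)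
    (hGZK : rank_eq_analyticRank_of_analyticRank_le_one)
    (hGS : ∀ (W : WeierstrassCurve ℚ) [W.IsElliptic] [W.IsGloballyMinimal] (p : ℕ) [Fact p.Prime],
      greenberg_stevens (W := W) (p := p))
    (hT1 : thm1_muAn_transfer_goodOrdinary_to_multiplicative)
    (hX : ClassX11a W p) (hp : 5 ≤ p) (hs : Surj W p)
    (hgoodA : A.HasGoodReductionAtPrime p) (hordA : ¬ (p : ℤ) ∣ A.frobeniusTrace p)
    (hiso : ∃ e : geomTorsion A (p : ℤ) ≃+ geomTorsion W (p : ℤ),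
      ∀ (σ : Field.absoluteGaloisGroup ℚ) (P : geomTorsion A (p : ℤ)), e (σ • P) = σ • e P)
    (hμA : ∀ [NeZero (A.conductorNorm ℤ)] (f₁ : CuspForm (Gamma0 (A.conductorNorm ℤ)) 2),
        IsNewformOf A f₁ → ∀ (ϖ₁ : ℚ), (ϖ₁ : ℝ) * A.realPeriodRat = plusPeriod f₁ →
      ∃ n : ℕ, ‖PowerSeries.coeff n
        (PowerSeries.C (ϖ₁ : ℚ_[p]) * padicLFunction f₁ (unitRoot A p : ℚ_[p]))‖ = 1) :
    BSDp W p :=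
  X11a.forall_bsdp_of_namedFacts_ofLevel_heightFree hNf h311 hT1a hT2 hT1b h61 h326 hKato hJs hJn
    hGZK hGS W p hX hp hs
    (muAnZeroAt_of_goodOrdinaryPartner W A p hT1 hp hX.2.2.1 hX.2.2.2.1 hgoodA hordA hiso hμA)

/-- **The LOWER HALF `ord_p #Ш(E)_an ≤ ord_p #Ш(E)` (Miller's currency, the body of crux
`X11aLowerHalf` at the pair) at an X11a pair with `p ≥ 5`, `ρ̄` onto and a good-ordinary
`p`-congruent partner with `μ^an = 0`** — from `bsdp_of_goodOrdinaryPartner_of_surj` (`Ш` finite by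
GZK in analytic rank `0`). [cite: Miller2011LMS, Def. 1.1] [cite: EmertonPollackWeston2006, Thm. 1] -/
theorem missingLowerBoundAt_of_goodOrdinaryPartner_of_surj (hNf : exists_isNewformOf)
    (h311 : thm311_cotorsion_weightK_member_ofLevel) (hT1a : thm1_muAlg_of_weightK_member_ofLevel)
    (hT2 : Wan2015.thm4_rational_weightK_member_of_bdd_ofLevel)
    (hT1b : thm513_transfer_from_weightK_member_of_bdd_ofLevel)
    (h61 : DeligneSerre1974.thm61_exists_adicGaloisRep) (h326 : Hida2000_thm326_ordinary)
    (hKato : kato_charIdeal_dvd_multiplicative_of_surjective)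
    (hJs : thm61_splitMultiplicative) (hJn : thm61_nonsplitMultiplicative)
    (hGZK : rank_eq_analyticRank_of_analyticRank_le_one)
    (hGS : ∀ (W : WeierstrassCurve ℚ) [W.IsElliptic] [W.IsGloballyMinimal] (p : ℕ) [Fact p.Prime],
      greenberg_stevens (W := W) (p := p))
    (hT1 : thm1_muAn_transfer_goodOrdinary_to_multiplicative)
    (hX : ClassX11a W p) (hp : 5 ≤ p) (hs : Surj W p)
    (hgoodA : A.HasGoodReductionAtPrime p) (hordA : ¬ (p : ℤ) ∣ A.frobeniusTrace p)
    (hiso : ∃ e : geomTorsion A (p : ℤ) ≃+ geomTorsion W (p : ℤ),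
      ∀ (σ : Field.absoluteGaloisGroup ℚ) (P : geomTorsion A (p : ℤ)), e (σ • P) = σ • e P)
    (hμA : ∀ [NeZero (A.conductorNorm ℤ)] (f₁ : CuspForm (Gamma0 (A.conductorNorm ℤ)) 2),
        IsNewformOf A f₁ → ∀ (ϖ₁ : ℚ), (ϖ₁ : ℝ) * A.realPeriodRat = plusPeriod f₁ →
      ∃ n : ℕ, ‖PowerSeries.coeff n
        (PowerSeries.C (ϖ₁ : ℚ_[p]) * padicLFunction f₁ (unitRoot A p : ℚ_[p]))‖ = 1) :
    MissingLowerBoundAt W p := by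
  have hB : BSDp W p := bsdp_of_goodOrdinaryPartner_of_surj W A p hNf h311 hT1a hT2 hT1b h61 h326
    hKato hJs hJn hGZK hGS hT1 hX hp hs hgoodA hordA hiso hμA
  have hr : W.analyticRank ≤ 1 := by rw [hX.1]; exact zero_le_one
  haveI : Finite W.sha := (hGZK W hr).2
  exact (lower_and_upper_of_missingPPartAt W p (missingPPartAt_of_bsdp W p hB)).1

/-- **`BSD(E,p)` at a surjective X11a pair from a partner certified by a modular-symbol engine**
(a unit coefficient of `L_p(f, α_A)` for every newform `f` of `A`, `hcertA`), granted additionally the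
period unit `h5` (Greenberg–Vatsal Rem. 3.4, cite-only). The record-level door of this road.
[cite: EmertonPollackWeston2006, Thm. 1] [cite: GreenbergVatsal2000, §3 Remark (3.4)] -/
theorem bsdp_of_unitCoeffPartner_of_surj (hNf : exists_isNewformOf)
    (h311 : thm311_cotorsion_weightK_member_ofLevel) (hT1a : thm1_muAlg_of_weightK_member_ofLevel)
    (hT2 : Wan2015.thm4_rational_weightK_member_of_bdd_ofLevel)
    (hT1b : thm513_transfer_from_weightK_member_of_bdd_ofLevel)
    (h61 : DeligneSerre1974.thm61_exists_adicGaloisRep) (h326 : Hida2000_thm326_ordinary)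
    (hKato : kato_charIdeal_dvd_multiplicative_of_surjective)
    (hJs : thm61_splitMultiplicative) (hJn : thm61_nonsplitMultiplicative)
    (hGZK : rank_eq_analyticRank_of_analyticRank_le_one)
    (hGS : ∀ (W : WeierstrassCurve ℚ) [W.IsElliptic] [W.IsGloballyMinimal] (p : ℕ) [Fact p.Prime],
      greenberg_stevens (W := W) (p := p))
    (hT1 : thm1_muAn_transfer_goodOrdinary_to_multiplicative)
    (h5 : realPeriodRat_eq_unit_mul_plusPeriod)
    (hX : ClassX11a W p) (hp : 5 ≤ p) (hs : Surj W p)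
    (hgoodA : A.HasGoodReductionAtPrime p) (hordA : ¬ (p : ℤ) ∣ A.frobeniusTrace p)
    (hiso : ∃ e : geomTorsion A (p : ℤ) ≃+ geomTorsion W (p : ℤ),
      ∀ (σ : Field.absoluteGaloisGroup ℚ) (P : geomTorsion A (p : ℤ)), e (σ • P) = σ • e P)
    (hcertA : ∀ {N : ℕ} [NeZero N] (f : CuspForm (Gamma0 N) 2), IsNewformOf A f →
      ∃ n : ℕ, ‖PowerSeries.coeff n (padicLFunction f (unitRoot A p : ℚ_[p]))‖ = 1) :
    BSDp W p :=
  X11a.forall_bsdp_of_namedFacts_ofLevel_heightFree hNf h311 hT1a hT2 hT1b h61 h326 hKato hJs hJn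
    hGZK hGS W p hX hp hs
    (muAnZeroAt_of_unitCoeffPartner W A p hT1 h5 hp hX.2.2.1 hX.2.2.2.1 hgoodA hordA hiso hcertA)

/-- **`BSD(E,p)` at a surjective X11a pair from a NON-ANOMALOUS UNIT-`L`-VALUE partner** — no engine:
`p ∤ #Ã(𝔽_p)`, `L(A,1)/Ω_A = q ≠ 0` with `ord_p q = 0` (in rank `0`: `p ∤ #Ш(A)_an·∏ c_ℓ(A)`),
granted additionally the period unit `h5`. Every binder is a published fact or a finite per-pair
datum (the `Γ_ℚ`-isomorphism `hiso` by Kraus–Oesterlé's finite trace comparison).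
[cite: MazurTateTeitelbaum1986Invent, §I.14 (14.3)] [cite: GreenbergVatsal2000, §3 Remark (3.4)]
[cite: EmertonPollackWeston2006, Thm. 1] -/
theorem bsdp_of_unitLValuePartner_of_surj (hNf : exists_isNewformOf)
    (h311 : thm311_cotorsion_weightK_member_ofLevel) (hT1a : thm1_muAlg_of_weightK_member_ofLevel)
    (hT2 : Wan2015.thm4_rational_weightK_member_of_bdd_ofLevel)
    (hT1b : thm513_transfer_from_weightK_member_of_bdd_ofLevel)
    (h61 : DeligneSerre1974.thm61_exists_adicGaloisRep) (h326 : Hida2000_thm326_ordinary)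
    (hKato : kato_charIdeal_dvd_multiplicative_of_surjective)
    (hJs : thm61_splitMultiplicative) (hJn : thm61_nonsplitMultiplicative)
    (hGZK : rank_eq_analyticRank_of_analyticRank_le_one)
    (hGS : ∀ (W : WeierstrassCurve ℚ) [W.IsElliptic] [W.IsGloballyMinimal] (p : ℕ) [Fact p.Prime],
      greenberg_stevens (W := W) (p := p))
    (hT1 : thm1_muAn_transfer_goodOrdinary_to_multiplicative)
    (h5 : realPeriodRat_eq_unit_mul_plusPeriod)
    (hX : ClassX11a W p) (hp : 5 ≤ p) (hs : Surj W p)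
    (hgoodA : A.HasGoodReductionAtPrime p) (hordA : ¬ (p : ℤ) ∣ A.frobeniusTrace p)
    (hiso : ∃ e : geomTorsion A (p : ℤ) ≃+ geomTorsion W (p : ℤ),
      ∀ (σ : Field.absoluteGaloisGroup ℚ) (P : geomTorsion A (p : ℤ)), e (σ • P) = σ • e P)
    (hna : ¬ p ∣ A.reductionPointCount p)
    {q : ℚ} (hq0 : q ≠ 0) (hL : A.entireLFunction 1 / (A.realPeriodRat : ℂ) = (q : ℂ))
    (hq : padicValRat p q = 0) :
    BSDp W p :=
  X11a.forall_bsdp_of_namedFacts_ofLevel_heightFree hNf h311 hT1a hT2 hT1b h61 h326 hKato hJs hJn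
    hGZK hGS W p hX hp hs
    (muAnZeroAt_of_unitLValuePartner W A p hT1 h5 hp hX.2.2.1 hX.2.2.2.1 hgoodA hordA hiso hna hq0
      hL hq)

end Pair

/-! ### §3 The surjective `p ≥ 5` sub-leaf of crux 19064, and the crux BY NAME, from partners -/

/-- **Road p2 on the surjective sub-leaf of crux `X11aLowerHalf`**: granted the 12 chain facts and
EPW Thm. 1 (an), IF every X11a pair with `p ≥ 5` and `ρ̄` onto admits a globally minimal good-ordinary
`p`-congruent partner with the Greenberg–Vatsal-shaped certificate `μ^an(A,p) = 0`, THEN the lower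
half holds on that sub-leaf. `hpartner` is NOT a published fact and NOT claimed (it fails at très
ramifié pairs; class-wide it is Greenberg's `μ`-conjecture shrunk to one member per `ρ̄`).
[cite: EmertonPollackWeston2006, Thm. 1] [cite: GreenbergLNM1716, Conj. 1.11] -/
theorem x11aLowerHalf_onSurjFive_of_forall_exists_goodOrdinaryPartner (hNf : exists_isNewformOf)
    (h311 : thm311_cotorsion_weightK_member_ofLevel) (hT1a : thm1_muAlg_of_weightK_member_ofLevel)
    (hT2 : Wan2015.thm4_rational_weightK_member_of_bdd_ofLevel)
    (hT1b : thm513_transfer_from_weightK_member_of_bdd_ofLevel)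
    (h61 : DeligneSerre1974.thm61_exists_adicGaloisRep) (h326 : Hida2000_thm326_ordinary)
    (hKato : kato_charIdeal_dvd_multiplicative_of_surjective)
    (hJs : thm61_splitMultiplicative) (hJn : thm61_nonsplitMultiplicative)
    (hGZK : rank_eq_analyticRank_of_analyticRank_le_one)
    (hGS : ∀ (W : WeierstrassCurve ℚ) [W.IsElliptic] [W.IsGloballyMinimal] (p : ℕ) [Fact p.Prime],
      greenberg_stevens (W := W) (p := p))
    (hT1 : thm1_muAn_transfer_goodOrdinary_to_multiplicative)
    (hpartner : ∀ (W : WeierstrassCurve ℚ) [W.IsElliptic] [W.IsGloballyMinimal] (p : ℕ)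
      [Fact p.Prime], ClassX11a W p → 5 ≤ p → Surj W p →
      ∃ (A : WeierstrassCurve ℚ) (_ : A.IsElliptic) (_ : A.IsGloballyMinimal),
        A.HasGoodReductionAtPrime p ∧ ¬ (p : ℤ) ∣ A.frobeniusTrace p ∧
        (∃ e : geomTorsion A (p : ℤ) ≃+ geomTorsion W (p : ℤ),
          ∀ (σ : Field.absoluteGaloisGroup ℚ) (P : geomTorsion A (p : ℤ)), e (σ • P) = σ • e P) ∧
        (∀ [NeZero (A.conductorNorm ℤ)] (f₁ : CuspForm (Gamma0 (A.conductorNorm ℤ)) 2),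
            IsNewformOf A f₁ → ∀ (ϖ₁ : ℚ), (ϖ₁ : ℝ) * A.realPeriodRat = plusPeriod f₁ →
          ∃ n : ℕ, ‖PowerSeries.coeff n
            (PowerSeries.C (ϖ₁ : ℚ_[p]) * padicLFunction f₁ (unitRoot A p : ℚ_[p]))‖ = 1)) :
    ∀ (W : WeierstrassCurve ℚ) [W.IsElliptic] [W.IsGloballyMinimal] (p : ℕ) [Fact p.Prime],
      ClassX11a W p → 5 ≤ p → Surj W p → MissingLowerBoundAt W p := by
  intro W _ _ p _ hX hp hs
  obtain ⟨A, _, _, hgoodA, hordA, hiso, hμA⟩ := hpartner W p hX hp hs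
  exact missingLowerBoundAt_of_goodOrdinaryPartner_of_surj W A p hNf h311 hT1a hT2 hT1b h61 h326
    hKato hJs hJn hGZK hGS hT1 hX hp hs hgoodA hordA hiso (fun f₁ hf₁ ϖ₁ hϖ₁ => hμA f₁ hf₁ ϖ₁ hϖ₁)

/-- **Crux `X11aLowerHalf` BY NAME (item stmt-BirchSwinnertonDyer-19064) from road p2's displayed
hypothesis on the surjective `p ≥ 5` sub-leaf plus the `p = 3` and non-surjective sub-leaf
statements** (case split as in p1's `x11aLowerHalf_of_subleaves`). Three displayed inputs, none
claimed; it records where this road sits in the crux. [cite: EmertonPollackWeston2006, Thm. 1]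
[cite: Miller2011LMS, Def. 1.1] -/
theorem x11aLowerHalf_of_forall_exists_goodOrdinaryPartner_of_three_of_nonSurj
    (hNf : exists_isNewformOf)
    (h311 : thm311_cotorsion_weightK_member_ofLevel) (hT1a : thm1_muAlg_of_weightK_member_ofLevel)
    (hT2 : Wan2015.thm4_rational_weightK_member_of_bdd_ofLevel)
    (hT1b : thm513_transfer_from_weightK_member_of_bdd_ofLevel)
    (h61 : DeligneSerre1974.thm61_exists_adicGaloisRep) (h326 : Hida2000_thm326_ordinary)
    (hKato : kato_charIdeal_dvd_multiplicative_of_surjective)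
    (hJs : thm61_splitMultiplicative) (hJn : thm61_nonsplitMultiplicative)
    (hGZK : rank_eq_analyticRank_of_analyticRank_le_one)
    (hGS : ∀ (W : WeierstrassCurve ℚ) [W.IsElliptic] [W.IsGloballyMinimal] (p : ℕ) [Fact p.Prime],
      greenberg_stevens (W := W) (p := p))
    (hT1 : thm1_muAn_transfer_goodOrdinary_to_multiplicative)
    (hpartner : ∀ (W : WeierstrassCurve ℚ) [W.IsElliptic] [W.IsGloballyMinimal] (p : ℕ)
      [Fact p.Prime], ClassX11a W p → 5 ≤ p → Surj W p →
      ∃ (A : WeierstrassCurve ℚ) (_ : A.IsElliptic) (_ : A.IsGloballyMinimal),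
        A.HasGoodReductionAtPrime p ∧ ¬ (p : ℤ) ∣ A.frobeniusTrace p ∧
        (∃ e : geomTorsion A (p : ℤ) ≃+ geomTorsion W (p : ℤ),
          ∀ (σ : Field.absoluteGaloisGroup ℚ) (P : geomTorsion A (p : ℤ)), e (σ • P) = σ • e P) ∧
        (∀ [NeZero (A.conductorNorm ℤ)] (f₁ : CuspForm (Gamma0 (A.conductorNorm ℤ)) 2),
            IsNewformOf A f₁ → ∀ (ϖ₁ : ℚ), (ϖ₁ : ℝ) * A.realPeriodRat = plusPeriod f₁ →
          ∃ n : ℕ, ‖PowerSeries.coeff n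
            (PowerSeries.C (ϖ₁ : ℚ_[p]) * padicLFunction f₁ (unitRoot A p : ℚ_[p]))‖ = 1))
    (h3 : ∀ (W : WeierstrassCurve ℚ) [W.IsElliptic] [W.IsGloballyMinimal] (p : ℕ) [Fact p.Prime],
      ClassX11a W p → p = 3 → MissingLowerBoundAt W p)
    (h5n : ∀ (W : WeierstrassCurve ℚ) [W.IsElliptic] [W.IsGloballyMinimal] (p : ℕ) [Fact p.Prime],
      ClassX11a W p → 5 ≤ p → ¬ Surj W p → MissingLowerBoundAt W p) :
    Summit.BirchSwinnertonDyer.BirchSwinnertonDyer.Theses.PrintX11a.X11aLowerHalf := by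
  unfold Summit.BirchSwinnertonDyer.BirchSwinnertonDyer.Theses.PrintX11a.X11aLowerHalf
  intro W _ _ p _ hX
  have hpP : p.Prime := Fact.out
  by_cases hp3 : p = 3
  · exact h3 W p hX hp3
  · have hp5 : 5 ≤ p := hpP.five_le_of_ne_two_of_ne_three hX.2.1 hp3
    by_cases hs : Surj W p
    · exact x11aLowerHalf_onSurjFive_of_forall_exists_goodOrdinaryPartner hNf h311 hT1a hT2 hT1b
        h61 h326 hKato hJs hJn hGZK hGS hT1 hpartner W p hX hp5 hs
    · exact h5n W p hX hp5 hs

end Summit.BirchSwinnertonDyer.BirchSwinnertonDyer.Theorems.MuTransport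

end
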